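import Summits.Schanuel.Schanuel.Theorems.ZilberEacFibreCurvePuiseux
import Summits.Schanuel.Schanuel.Theorems.ZilberEacEliminantThree
import Mathlib.Algebra.MvPolynomial.Funext
import HarnessLib

/-!
# Arbitrary base branches, C: PUISEUX ROOT OF A RELATION `G(x₀, x₁, y₁; y₀) = 0` ALONG A BOUNDED
# PLACE WITH `y₁ = e^{x₁}` SUBSTITUTED (O90 (a): surfaces whose equations involve `y₁`)

HONEST FRAMING.  Cell `pub-schanuel` (Zilber's Exponential-Algebraic Closedness, case ladder;
host summit Schanuel), seat 2, gen 33.  Along a BOUNDED place `x₀ = s^{-k}`, `x₁ = Φ(s) → θ` of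
an irreducible curve `F = 0` of `x₁`-degree `≥ 2`, the second exponential `y₁ = e^{x₁} = e^{Φ(s)}`
is ANALYTIC in `s`; so a relation `G(x₀, x₁, y₁; y₀) = 0` (`G ∈ ℂ[x₀, x₁, y₁][y₀]`, the
coefficient ring presented as `MvPolynomial (Fin 3) ℂ` to keep typeclass search shallow) becomes a
polynomial in `y₀` whose rows `G_j(s^{-k}, Φ(s), e^{Φ(s)})` are meromorphic germs — the input of
the analytic Newton–Puiseux theorem (file XCI).  Rows `∉ (F)` do not vanish identically along the
place (file XCIX, through the rows equivalence `ℂ[x₀, x₁, y₁] ≅ ℂ[x₀][x₁][y₁]` proved here), and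
`G p + ∂G q = Res_{y₀}(G, ∂G)` (Mathlib) is the Bézout element.  Result:
**`exists_relation_puiseuxRoot_boundedPlace`** — if the top coefficient, the bottom coefficient and
the `y₀`-discriminant of `G` are not divisible by `F`, there are `e ≥ 1`, `L ∈ ℤ`, `ψ` analytic
with `ψ(0) ≠ 0` and `G(x₀(σ^e), x₁(σ^e), e^{x₁(σ^e)}; ψ(σ)σ^L) = 0` for small `σ ≠ 0` — the fibre
datum of the bounded engine (file LXVII); no `ℚ̄` hypothesis anywhere.  [folklore
(Newton–Puiseux), made concrete]; nothing here is specific to Schanuel's conjecture (neither used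
nor implied); Mantova–Masser's question (PLMS 2024 §1 p. 5) and EC(3,2) stay OPEN; EAC ⇏ SC.
-/

noncomputable section

open Filter Topology Set Complex Polynomial

set_option linter.dupNamespace false

namespace Summit.Schanuel.Schanuel.Theorems

section RelationPuiseux

/-! ## Part A. `ℂ[x₀, x₁, y₁] ≅ ℂ[x₀][x₁][y₁]` with evaluations -/

/-- Three-variable polynomials in rows form with equal values are equal. [folklore] -/
theorem polyPolyPoly_eq_of_eval_eq {Q₁ Q₂ : Polynomial ℂ[X][X]}
    (h : ∀ a b c : ℂ, (Q₁.map (Polynomial.eval₂RingHom (Polynomial.evalRingHom a) b)).eval c =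
      (Q₂.map (Polynomial.eval₂RingHom (Polynomial.evalRingHom a) b)).eval c) : Q₁ = Q₂ := by
  have hab : ∀ a b : ℂ, Q₁.map (Polynomial.eval₂RingHom (Polynomial.evalRingHom a) b) =
      Q₂.map (Polynomial.eval₂RingHom (Polynomial.evalRingHom a) b) :=
    fun a b => Polynomial.funext fun c => h a b c
  ext m : 1
  refine polyPoly_eq_of_eval_eq fun a b => ?_
  have := congrArg (fun q : ℂ[X] => q.coeff m) (hab a b)
  simpa only [Polynomial.coeff_map, Polynomial.coe_eval₂RingHom, Polynomial.eval₂_eq_eval_map]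
    using this

/-- **The rows equivalence in three variables** `κ : ℂ[x₀, x₁, y₁] ≅ ℂ[x₀][x₁][y₁]`,
`κ(P)(a)(b)(c) = P(a, b, c)`. [folklore] -/
theorem exists_rowsEquiv₃ :
    ∃ κ : MvPolynomial (Fin 3) ℂ ≃+* Polynomial ℂ[X][X], ∀ (P : MvPolynomial (Fin 3) ℂ) (a b c : ℂ),
      MvPolynomial.eval ![a, b, c] P =
        ((κ P).map (Polynomial.eval₂RingHom (Polynomial.evalRingHom a) b)).eval c := by
  classical
  set κ₀ : MvPolynomial (Fin 3) ℂ →+* Polynomial ℂ[X][X] :=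
    MvPolynomial.eval₂Hom (S₁ := Polynomial ℂ[X][X])
      ((Polynomial.C : ℂ[X][X] →+* Polynomial ℂ[X][X]).comp
        ((Polynomial.C : ℂ[X] →+* ℂ[X][X]).comp (Polynomial.C : ℂ →+* ℂ[X])))
      (![Polynomial.C (Polynomial.C Polynomial.X), Polynomial.C Polynomial.X, Polynomial.X] :
        Fin 3 → Polynomial ℂ[X][X]) with hκ₀
  set lam : Polynomial ℂ[X][X] →+* MvPolynomial (Fin 3) ℂ := Polynomial.eval₂RingHom
    (Polynomial.eval₂RingHom (Polynomial.eval₂RingHom MvPolynomial.C (MvPolynomial.X 0))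
      (MvPolynomial.X 1)) (MvPolynomial.X 2) with hlam
  have hκC : ∀ r : ℂ, κ₀ (MvPolynomial.C r) = Polynomial.C (Polynomial.C (Polynomial.C r)) := by
    intro r; simp only [hκ₀, MvPolynomial.coe_eval₂Hom, MvPolynomial.eval₂_C, RingHom.comp_apply]
  have hκ0 : κ₀ (MvPolynomial.X 0) = Polynomial.C (Polynomial.C Polynomial.X) := by
    simp only [hκ₀, MvPolynomial.coe_eval₂Hom, MvPolynomial.eval₂_X, Matrix.cons_val_zero]
  have hκ1 : κ₀ (MvPolynomial.X 1) = Polynomial.C Polynomial.X := by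
    simp only [hκ₀, MvPolynomial.coe_eval₂Hom, MvPolynomial.eval₂_X, Matrix.cons_val_one,
      Matrix.cons_val_zero]
  have hκ2 : κ₀ (MvPolynomial.X 2) = Polynomial.X := by
    simp only [hκ₀, MvPolynomial.coe_eval₂Hom, MvPolynomial.eval₂_X]; rfl
  have hlC : ∀ r : ℂ, lam (Polynomial.C (Polynomial.C (Polynomial.C r))) = MvPolynomial.C r := by
    intro r; simp only [hlam, Polynomial.coe_eval₂RingHom, Polynomial.eval₂_C]
  have hl0 : lam (Polynomial.C (Polynomial.C Polynomial.X)) = MvPolynomial.X 0 := by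
    simp only [hlam, Polynomial.coe_eval₂RingHom, Polynomial.eval₂_C, Polynomial.eval₂_X]
  have hl1 : lam (Polynomial.C Polynomial.X) = MvPolynomial.X 1 := by
    simp only [hlam, Polynomial.coe_eval₂RingHom, Polynomial.eval₂_C, Polynomial.eval₂_X]
  have hl2 : lam Polynomial.X = MvPolynomial.X 2 := by
    simp only [hlam, Polynomial.coe_eval₂RingHom, Polynomial.eval₂_X]
  -- `lam ∘ κ₀ = id`
  have h₁ : lam.comp κ₀ = RingHom.id _ := by
    refine MvPolynomial.ringHom_ext (fun r => ?_) (fun i => ?_)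
    · rw [RingHom.comp_apply, hκC, hlC, RingHom.id_apply]
    · rw [RingHom.comp_apply, RingHom.id_apply]
      fin_cases i
      · show lam (κ₀ (MvPolynomial.X 0)) = MvPolynomial.X 0; rw [hκ0, hl0]
      · show lam (κ₀ (MvPolynomial.X 1)) = MvPolynomial.X 1; rw [hκ1, hl1]
      · show lam (κ₀ (MvPolynomial.X 2)) = MvPolynomial.X 2; rw [hκ2, hl2]
  -- `κ₀ ∘ lam = id` (three nested extensionality steps)
  have e₁ : (κ₀.comp lam).comp (Polynomial.C.comp Polynomial.C) =
      (Polynomial.C : ℂ[X][X] →+* Polynomial ℂ[X][X]).comp Polynomial.C := by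
    refine Polynomial.ringHom_ext (fun r => ?_) ?_
    · simp only [RingHom.comp_apply, hlC, hκC]
    · simp only [RingHom.comp_apply, hl0, hκ0]
  have e₂ : (κ₀.comp lam).comp Polynomial.C = (Polynomial.C : ℂ[X][X] →+* Polynomial ℂ[X][X]) := by
    refine Polynomial.ringHom_ext (fun r => ?_) ?_
    · have h := congrArg (fun f : ℂ[X] →+* Polynomial ℂ[X][X] => f r) e₁
      simp only [RingHom.comp_apply] at h ⊢
      exact h
    · simp only [RingHom.comp_apply, hl1, hκ1]
  have h₂ : κ₀.comp lam = RingHom.id _ := by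
    refine Polynomial.ringHom_ext (fun r => ?_) ?_
    · have h := congrArg (fun f : ℂ[X][X] →+* Polynomial ℂ[X][X] => f r) e₂
      simp only [RingHom.comp_apply] at h ⊢
      rw [h, RingHom.id_apply]
    · rw [RingHom.comp_apply, hl2, hκ2, RingHom.id_apply]
  refine ⟨RingEquiv.ofRingHom κ₀ lam h₂ h₁, fun P a b c => ?_⟩
  rw [RingEquiv.ofRingHom_apply, Polynomial.eval_map, ← Polynomial.coe_eval₂RingHom]
  -- both sides are ring homomorphisms in `P` agreeing on generators
  change MvPolynomial.eval ![a, b, c] P = ((Polynomial.eval₂RingHom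
    (Polynomial.eval₂RingHom (Polynomial.evalRingHom a) b) c).comp κ₀) P
  congr 1
  refine MvPolynomial.ringHom_ext (fun r => ?_) (fun i => ?_)
  · rw [RingHom.comp_apply, hκC, MvPolynomial.eval_C]
    simp only [Polynomial.coe_eval₂RingHom, Polynomial.eval₂_C, Polynomial.coe_evalRingHom,
      Polynomial.eval_C]
  · rw [RingHom.comp_apply, MvPolynomial.eval_X]
    fin_cases i
    · show (![a, b, c] : Fin 3 → ℂ) 0 = (Polynomial.eval₂RingHom
        (Polynomial.eval₂RingHom (Polynomial.evalRingHom a) b) c) (κ₀ (MvPolynomial.X 0))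
      rw [hκ0]
      simp only [Matrix.cons_val_zero, Polynomial.coe_eval₂RingHom, Polynomial.eval₂_C,
        Polynomial.coe_evalRingHom, Polynomial.eval_X]
    · show (![a, b, c] : Fin 3 → ℂ) 1 = (Polynomial.eval₂RingHom
        (Polynomial.eval₂RingHom (Polynomial.evalRingHom a) b) c) (κ₀ (MvPolynomial.X 1))
      rw [hκ1]
      simp only [Matrix.cons_val_one, Matrix.cons_val_zero, Polynomial.coe_eval₂RingHom,
        Polynomial.eval₂_C, Polynomial.eval₂_X]
    · show (![a, b, c] : Fin 3 → ℂ) 2 = (Polynomial.eval₂RingHom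
        (Polynomial.eval₂RingHom (Polynomial.evalRingHom a) b) c) (κ₀ (MvPolynomial.X 2))
      rw [hκ2]
      simp only [Polynomial.coe_eval₂RingHom, Polynomial.eval₂_X]
      rfl

variable (F : ℂ[X][X])

/-! ## Part B. Transcendence of `e^{x₁}` over `(x₀, x₁)` along a bounded branch, `MvPolynomial` form -/

/-- **`H(s^{-k}, Φ(s), e^{Φ(s)}) ≢ 0` for `H ∈ ℂ[x₀, x₁, y₁]` not divisible by the curve
polynomial** (`F₃` = `F` inside `ℂ[x₀, x₁, y₁]`, given through its values). [folklore] -/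
theorem not_eventually_relation_exp_boundedBranch_mv (hFirr : Irreducible F) (hn2 : 2 ≤ F.natDegree)
    {k : ℕ} (hk : 1 ≤ k) {Φ : ℂ → ℂ} (hΦan : AnalyticAt ℂ Φ 0)
    (hplace : ∀ᶠ s in 𝓝[≠] (0 : ℂ), (F.map (Polynomial.evalRingHom (s ^ k)⁻¹)).eval (Φ s) = 0)
    (F₃ : MvPolynomial (Fin 3) ℂ)
    (hF₃ : ∀ v : Fin 3 → ℂ, MvPolynomial.eval v F₃ = (F.map (Polynomial.evalRingHom (v 0))).eval (v 1))
    (H : MvPolynomial (Fin 3) ℂ) (hH : ¬ F₃ ∣ H) :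
    ¬ ∀ᶠ u in 𝓝[≠] (0 : ℂ), MvPolynomial.eval ![(u ^ k)⁻¹, Φ u, Complex.exp (Φ u)] H = 0 := by
  classical
  obtain ⟨κ, hκ⟩ := exists_rowsEquiv₃
  -- `κ⁻¹ (C F) = F₃` (same values)
  have hκF : κ.symm (Polynomial.C F) = F₃ := by
    refine MvPolynomial.funext fun v => ?_
    have e : v = ![v 0, v 1, v 2] := by funext i; fin_cases i <;> rfl
    rw [hF₃, e, hκ, RingEquiv.apply_symm_apply, Polynomial.map_C, Polynomial.eval_C,
      Polynomial.coe_eval₂RingHom, Polynomial.eval₂_eq_eval_map]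
    rfl
  -- some `y₁`-coefficient of `κ H` is not divisible by `F`
  have hcoef : ∃ m, ¬ F ∣ (κ H).coeff m := by
    by_contra hall
    push Not at hall
    obtain ⟨Q, hQ⟩ := (Polynomial.C_dvd_iff_dvd_coeff F (κ H)).2 hall
    apply hH
    refine ⟨κ.symm Q, ?_⟩
    apply κ.injective
    rw [map_mul, RingEquiv.apply_symm_apply, ← hκF, RingEquiv.apply_symm_apply]
    exact hQ
  intro hev
  apply not_eventually_relation₃_exp_boundedBranch F hFirr hn2 hk hΦan hplace (κ H) hcoef
  filter_upwards [hev] with u hu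
  rw [← hκ]
  exact hu

/-! ## Part C. Rows along a bounded place with `y₁ = e^{x₁}` -/

/-- **A row along a bounded place with `y₁ = e^{x₁}` substituted**: for `H ∈ ℂ[x₀, x₁, y₁]` there
are `n` and `ρ` analytic at `0` with `s^n · H(s^{-k}, Φ(s), e^{Φ(s)}) = ρ(s)` for small `s ≠ 0`.
[folklore] -/
theorem exists_row_mv_along_boundedPlace (hFirr : Irreducible F) (hn : 1 ≤ F.natDegree) {k : ℕ}
    (hk : 1 ≤ k) {Φ : ℂ → ℂ} (hΦan : AnalyticAt ℂ Φ 0)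
    (hplace : ∀ᶠ s in 𝓝[≠] (0 : ℂ), (F.map (Polynomial.evalRingHom (s ^ k)⁻¹)).eval (Φ s) = 0)
    (H : MvPolynomial (Fin 3) ℂ) :
    ∃ (n : ℕ) (ρ : ℂ → ℂ), AnalyticAt ℂ ρ 0 ∧ ∀ᶠ s in 𝓝[≠] (0 : ℂ),
      s ^ n * MvPolynomial.eval ![(s ^ k)⁻¹, Φ s, Complex.exp (Φ s)] H = ρ s := by
  classical
  obtain ⟨κ, hκ⟩ := exists_rowsEquiv₃
  have hplace0 : ∀ᶠ s in 𝓝[≠] (0 : ℂ),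
      (F.map (Polynomial.evalRingHom (s ^ k)⁻¹)).eval (Φ s * (s ^ 0)⁻¹) = 0 := by
    filter_upwards [hplace] with s hs
    rwa [pow_zero, inv_one, mul_one]
  have hrow := exists_row_along_place F hFirr hn hk 0 hΦan hplace0
  choose ψ L hψan _hψ0 hψev using fun m => hrow ((κ H).coeff m)
  set n : ℕ := (Finset.range ((κ H).natDegree + 1)).sup fun m => (-L m).toNat with hn'
  have hnm : ∀ m ∈ Finset.range ((κ H).natDegree + 1), 0 ≤ L m + n := by
    intro m hm
    have h1 : (-L m).toNat ≤ n := Finset.le_sup (f := fun m => (-L m).toNat) hm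
    have h2 := Int.self_le_toNat (-L m)
    omega
  refine ⟨n, fun s => ∑ m ∈ Finset.range ((κ H).natDegree + 1),
    ψ m s * s ^ (L m + n).toNat * Complex.exp (Φ s) ^ m, ?_, ?_⟩
  · exact Finset.analyticAt_fun_sum _ fun m _ =>
      (((hψan m).mul (analyticAt_id.pow _)).mul ((analyticAt_cexp.comp hΦan).pow m))
  · have hall : ∀ᶠ s in 𝓝[≠] (0 : ℂ), ∀ m ∈ Finset.range ((κ H).natDegree + 1),
        (((κ H).coeff m).map (Polynomial.evalRingHom (s ^ k)⁻¹)).eval (Φ s) = ψ m s * s ^ L m := by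
      refine (Finset.eventually_all _).2 fun m _ => ?_
      filter_upwards [hψev m] with s hs
      rwa [pow_zero, inv_one, mul_one] at hs
    filter_upwards [hall, self_mem_nhdsWithin] with s hs hs0
    replace hs0 : s ≠ 0 := hs0
    rw [hκ, eval_map_eq_rowSum (κ H) _ le_rfl, Finset.mul_sum]
    refine Finset.sum_congr rfl fun m hm => ?_
    rw [Polynomial.coe_eval₂RingHom, Polynomial.eval₂_eq_eval_map, hs m hm,
      ← pow_mul_mul_zpow_eq hs0 (ψ m s) (hnm m hm)]
    ring

/-- A row representative `s^{c}·ρ` of a row `∉ (F)` is not identically zero (file XCIX).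
[folklore] -/
theorem not_eventually_zero_row_mv (hFirr : Irreducible F) (hn2 : 2 ≤ F.natDegree) {k : ℕ}
    (hk : 1 ≤ k) {Φ : ℂ → ℂ} (hΦan : AnalyticAt ℂ Φ 0)
    (hplace : ∀ᶠ s in 𝓝[≠] (0 : ℂ), (F.map (Polynomial.evalRingHom (s ^ k)⁻¹)).eval (Φ s) = 0)
    (F₃ : MvPolynomial (Fin 3) ℂ)
    (hF₃ : ∀ v : Fin 3 → ℂ, MvPolynomial.eval v F₃ = (F.map (Polynomial.evalRingHom (v 0))).eval (v 1))
    {H : MvPolynomial (Fin 3) ℂ} (hH : ¬ F₃ ∣ H) {n : ℕ} {ρ : ℂ → ℂ}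
    (hρ : ∀ᶠ s in 𝓝[≠] (0 : ℂ),
      s ^ n * MvPolynomial.eval ![(s ^ k)⁻¹, Φ s, Complex.exp (Φ s)] H = ρ s) (c : ℕ) :
    ¬ ∀ᶠ s in 𝓝 (0 : ℂ), s ^ c * ρ s = 0 := by
  intro h0
  apply not_eventually_relation_exp_boundedBranch_mv F hFirr hn2 hk hΦan hplace F₃ hF₃ H hH
  filter_upwards [hρ, nhdsWithin_le_nhds h0, self_mem_nhdsWithin] with s hs h1 hs0
  replace hs0 : s ≠ 0 := hs0
  rw [← hs, ← mul_assoc] at h1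
  exact (mul_eq_zero.1 h1).resolve_left (mul_ne_zero (pow_ne_zero _ hs0) (pow_ne_zero _ hs0))

/-! ## Part D. The Puiseux root -/

/-- **Puiseux root of a relation involving `y₁` along a bounded place.**  See the module
docstring. [folklore (Newton–Puiseux), made concrete] (new in this form) -/
theorem exists_relation_puiseuxRoot_boundedPlace (hFirr : Irreducible F) (hn2 : 2 ≤ F.natDegree)
    {k : ℕ} (hk : 1 ≤ k) {Φ : ℂ → ℂ} (hΦan : AnalyticAt ℂ Φ 0)
    (hplace : ∀ᶠ s in 𝓝[≠] (0 : ℂ), (F.map (Polynomial.evalRingHom (s ^ k)⁻¹)).eval (Φ s) = 0)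
    (F₃ : MvPolynomial (Fin 3) ℂ)
    (hF₃ : ∀ v : Fin 3 → ℂ, MvPolynomial.eval v F₃ = (F.map (Polynomial.evalRingHom (v 0))).eval (v 1))
    (G : Polynomial (MvPolynomial (Fin 3) ℂ)) (hd : 1 ≤ G.natDegree) (htop : ¬ F₃ ∣ G.leadingCoeff)
    (hbot : ¬ F₃ ∣ G.coeff 0)
    (hdisc : ¬ F₃ ∣ Polynomial.resultant G (derivative G) G.natDegree (G.natDegree - 1)) :
    ∃ (e : ℕ) (L : ℤ) (ψ : ℂ → ℂ), 1 ≤ e ∧ AnalyticAt ℂ ψ 0 ∧ ψ 0 ≠ 0 ∧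
      ∀ᶠ σ in 𝓝[≠] (0 : ℂ),
        (G.map (MvPolynomial.eval ![((σ ^ e) ^ k)⁻¹, Φ (σ ^ e), Complex.exp (Φ (σ ^ e))])).eval
          (ψ σ * σ ^ L) = 0 := by
  classical
  have hn1 : 1 ≤ F.natDegree := by omega
  set d : ℕ := G.natDegree with hdG
  set χ : ℂ → (MvPolynomial (Fin 3) ℂ →+* ℂ) := fun s =>
    MvPolynomial.eval ![(s ^ k)⁻¹, Φ s, Complex.exp (Φ s)] with hχ
  -- Bézout
  obtain ⟨p, q, -, -, hpq⟩ := Polynomial.exists_mul_add_mul_eq_C_resultant G (derivative G)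
    (m := d) (n := d - 1) (le_of_eq hdG.symm)
    ((Polynomial.natDegree_derivative_le G).trans (by rw [← hdG])) (Or.inl (by omega))
  set res := Polynomial.resultant G (derivative G) d (d - 1) with hres
  set dA : ℕ := max p.natDegree q.natDegree with hdA
  -- rows
  have hrow := exists_row_mv_along_boundedPlace F hFirr hn1 hk hΦan hplace
  choose nG ρG hρGan hρGev using fun j => hrow (G.coeff j)
  choose np ρp hρpan hρpev using fun i => hrow (p.coeff i)
  choose nq ρq hρqan hρqev using fun i => hrow (q.coeff i)
  obtain ⟨nr, ρr, hρran, hρrev⟩ := hrow res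
  set N : ℕ := (Finset.range (d + 1)).sup nG with hN
  set NA : ℕ := (Finset.range (dA + 1)).sup (fun i => max (np i) (nq i)) + nr with hNA
  have hNj : ∀ j ∈ Finset.range (d + 1), nG j ≤ N := fun j hj => Finset.le_sup (f := nG) hj
  have hNAp : ∀ i ∈ Finset.range (dA + 1), np i ≤ NA := by
    intro i hi
    have h1 : max (np i) (nq i) ≤ (Finset.range (dA + 1)).sup fun i => max (np i) (nq i) :=
      Finset.le_sup (f := fun i => max (np i) (nq i)) hi
    have := le_max_left (np i) (nq i)
    omega
  have hNAq : ∀ i ∈ Finset.range (dA + 1), nq i ≤ NA := by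
    intro i hi
    have h1 : max (np i) (nq i) ≤ (Finset.range (dA + 1)).sup fun i => max (np i) (nq i) :=
      Finset.le_sup (f := fun i => max (np i) (nq i)) hi
    have := le_max_right (np i) (nq i)
    omega
  have hNr : nr ≤ N + NA := by omega
  set Q : ℕ → ℂ → ℂ := fun j s => s ^ (N - nG j) * ρG j s with hQ
  set A : ℕ → ℂ → ℂ := fun i s => s ^ (NA - np i) * ρp i s with hA
  set B : ℕ → ℂ → ℂ := fun i s => s ^ (NA - nq i) * ρq i s with hB
  set r : ℂ → ℂ := fun s => s ^ (N + NA - nr) * ρr s with hr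
  have hQan : ∀ j, AnalyticAt ℂ (Q j) 0 := fun j => (analyticAt_id.pow _).mul (hρGan j)
  have hAan : ∀ i, AnalyticAt ℂ (A i) 0 := fun i => (analyticAt_id.pow _).mul (hρpan i)
  have hBan : ∀ i, AnalyticAt ℂ (B i) 0 := fun i => (analyticAt_id.pow _).mul (hρqan i)
  have hran : AnalyticAt ℂ r 0 := (analyticAt_id.pow _).mul hρran
  have hQd : ¬ ∀ᶠ s in 𝓝 (0 : ℂ), Q d s = 0 :=
    not_eventually_zero_row_mv F hFirr hn2 hk hΦan hplace F₃ hF₃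
      (by rw [← Polynomial.coeff_natDegree] at htop; exact htop) (hρGev d) _
  have hQ0 : ¬ ∀ᶠ s in 𝓝 (0 : ℂ), Q 0 s = 0 :=
    not_eventually_zero_row_mv F hFirr hn2 hk hΦan hplace F₃ hF₃ hbot (hρGev 0) _
  have hr0 : ¬ ∀ᶠ s in 𝓝 (0 : ℂ), r s = 0 :=
    not_eventually_zero_row_mv F hFirr hn2 hk hΦan hplace F₃ hF₃ hdisc hρrev _
  -- the row identities on a punctured neighbourhood
  have hPdeg : G.natDegree ≤ d := le_of_eq hdG.symm
  have hpdeg : p.natDegree ≤ dA := le_max_left _ _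
  have hqdeg : q.natDegree ≤ dA := le_max_right _ _
  have hallG : ∀ᶠ s in 𝓝[≠] (0 : ℂ), ∀ j ∈ Finset.range (d + 1), Q j s = s ^ N * χ s (G.coeff j) := by
    refine (Finset.eventually_all _).2 fun j hj => ?_
    filter_upwards [hρGev j] with s hs
    show s ^ (N - nG j) * ρG j s = s ^ N * MvPolynomial.eval ![(s ^ k)⁻¹, Φ s, Complex.exp (Φ s)] (G.coeff j)
    rw [← hs, ← mul_assoc, ← pow_add, Nat.sub_add_cancel (hNj j hj)]
  have hallp : ∀ᶠ s in 𝓝[≠] (0 : ℂ), ∀ i ∈ Finset.range (dA + 1), A i s = s ^ NA * χ s (p.coeff i) := by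
    refine (Finset.eventually_all _).2 fun i hi => ?_
    filter_upwards [hρpev i] with s hs
    show s ^ (NA - np i) * ρp i s = s ^ NA * MvPolynomial.eval ![(s ^ k)⁻¹, Φ s, Complex.exp (Φ s)] (p.coeff i)
    rw [← hs, ← mul_assoc, ← pow_add, Nat.sub_add_cancel (hNAp i hi)]
  have hallq : ∀ᶠ s in 𝓝[≠] (0 : ℂ), ∀ i ∈ Finset.range (dA + 1), B i s = s ^ NA * χ s (q.coeff i) := by
    refine (Finset.eventually_all _).2 fun i hi => ?_
    filter_upwards [hρqev i] with s hs
    show s ^ (NA - nq i) * ρq i s = s ^ NA * MvPolynomial.eval ![(s ^ k)⁻¹, Φ s, Complex.exp (Φ s)] (q.coeff i)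
    rw [← hs, ← mul_assoc, ← pow_add, Nat.sub_add_cancel (hNAq i hi)]
  have hallr : ∀ᶠ s in 𝓝[≠] (0 : ℂ), r s = s ^ (N + NA) * χ s res := by
    filter_upwards [hρrev] with s hs
    show s ^ (N + NA - nr) * ρr s = s ^ (N + NA) * MvPolynomial.eval ![(s ^ k)⁻¹, Φ s, Complex.exp (Φ s)] res
    rw [← hs, ← mul_assoc, ← pow_add, Nat.sub_add_cancel hNr]
  -- Bézout along the place
  have hbez : ∀ᶠ s in 𝓝[≠] (0 : ℂ), ∀ y : ℂ,
      (∑ i ∈ Finset.range (dA + 1), A i s * y ^ i) *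
          (∑ j ∈ Finset.range (d + 1), Q j s * y ^ j) +
        (∑ i ∈ Finset.range (dA + 1), B i s * y ^ i) *
          (∑ j ∈ Finset.range (d + 1), (j : ℂ) * Q j s * y ^ (j - 1)) = r s := by
    filter_upwards [hallG, hallp, hallq, hallr] with s hG hp hq hrs y
    have eQ : ∑ j ∈ Finset.range (d + 1), Q j s * y ^ j = s ^ N * (G.map (χ s)).eval y := by
      rw [eval_map_eq_rowSum G (χ s) hPdeg, Finset.mul_sum]
      refine Finset.sum_congr rfl fun j hj => ?_
      rw [hG j hj]; ring
    have eQ' : ∑ j ∈ Finset.range (d + 1), (j : ℂ) * Q j s * y ^ (j - 1) =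
        s ^ N * ((derivative G).map (χ s)).eval y := by
      rw [eval_derivative_map_eq_rowSum G (χ s) hPdeg, Finset.mul_sum]
      refine Finset.sum_congr rfl fun j hj => ?_
      rw [hG j hj]; ring
    have eA : ∑ i ∈ Finset.range (dA + 1), A i s * y ^ i = s ^ NA * (p.map (χ s)).eval y := by
      rw [eval_map_eq_rowSum p (χ s) hpdeg, Finset.mul_sum]
      refine Finset.sum_congr rfl fun i hi => ?_
      rw [hp i hi]; ring
    have eB : ∑ i ∈ Finset.range (dA + 1), B i s * y ^ i = s ^ NA * (q.map (χ s)).eval y := by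
      rw [eval_map_eq_rowSum q (χ s) hqdeg, Finset.mul_sum]
      refine Finset.sum_congr rfl fun i hi => ?_
      rw [hq i hi]; ring
    have hb := congrArg (fun T : Polynomial (MvPolynomial (Fin 3) ℂ) => (T.map (χ s)).eval y) hpq
    simp only [Polynomial.map_add, Polynomial.map_mul, Polynomial.eval_add, Polynomial.eval_mul,
      Polynomial.map_C, Polynomial.eval_C] at hb
    rw [eQ, eQ', eA, eB, hrs, ← hb, pow_add]
    ring
  obtain ⟨e, L, ψ, he, hψan, hψ0, hroot⟩ := exists_puiseuxRoot_analyticRows d hd Q hQan hQd hQ0 dA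
    A B hAan hBan r hran hr0 hbez
  refine ⟨e, L, ψ, he, hψan, hψ0, ?_⟩
  have hpowT : Tendsto (fun σ : ℂ => σ ^ e) (𝓝[≠] (0 : ℂ)) (𝓝[≠] (0 : ℂ)) :=
    tendsto_nhdsWithin_iff.2 ⟨(tendsto_pow_nhds_zero e he).mono_left nhdsWithin_le_nhds,
      eventually_nhdsWithin_of_forall fun σ hσ => pow_ne_zero _ hσ⟩
  filter_upwards [hroot, hpowT.eventually hallG, hpowT.eventually self_mem_nhdsWithin]
    with σ hσ hG hs0
  replace hs0 : σ ^ e ≠ 0 := hs0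
  have eQ : ∑ j ∈ Finset.range (d + 1), Q j (σ ^ e) * (ψ σ * σ ^ L) ^ j =
      (σ ^ e) ^ N * (G.map (χ (σ ^ e))).eval (ψ σ * σ ^ L) := by
    rw [eval_map_eq_rowSum G (χ (σ ^ e)) hPdeg, Finset.mul_sum]
    refine Finset.sum_congr rfl fun j hj => ?_
    rw [hG j hj]; ring
  rw [eQ] at hσ
  exact (mul_eq_zero.1 hσ).resolve_left (pow_ne_zero _ hs0)

end RelationPuiseux

end Summit.Schanuel.Schanuel.Theorems
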